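import Summits.MatrixMultiplication.MatrixMultiplication.Theorems.ObstructionDescentGapPropagation
import Summits.MatrixMultiplication.MatrixMultiplication.Theorems.ObstructionDescentHullCalculus
import Summits.MatrixMultiplication.MatrixMultiplication.Theorems.ObstructionCalculusInvariants
import Literature.Computability.AlgebraicComplexity.AsymptoticRankZariskiClosedProofs

/- `set_option linter.dupNamespace false` as in the sibling kernel files (namespace `…Theorems.<FileStem>`). -/
set_option linter.dupNamespace false

/-!
# Obstruction descent — DOUBLE-DEGREE BLINDNESS (decides the aside `DoubleDegreeBlind`)

THEOREM (aside `DoubleDegreeBlind`, item 27780 of route `ObstructionDescent`; memo NODE-g23 §4, Corollary D).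
Let `2 ≤ N ≤ m` and let `f ∈ ℂ[(ℂ^m)^{⊗3}]` be a polynomial with `deg f + 3N ≤ 2m + 4` that vanishes on the orbit
`GL_m × GL_m × GL_m · ⟨m⟩` of the unit tensor.  Then `f` vanishes at `(A ⊗ B ⊗ C) · pad_m(t)` for EVERY corner tensor
`t ∈ (ℂ^N)^{⊗3}` and all matrices `A, B, C` — i.e. equations of `σ_m` of degree `≤ 2m − 3N + 4` cannot separate any
padded `N × N × N` tensor (in particular `⟨n,n,n⟩`, `N = n²`) from `σ_m`: the border-rank / occurrence-type
obstructions against `R̲(t) ≤ m` must live in degree `> 2(m + 2) − 3N`.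

PROOF (all in the tree now):
* §1 ORBIT ⟹ SECANT (`mem_RV_of_orbit`): vanishing on `GL_m³·⟨m⟩` gives vanishing on `Mat_m³·⟨m⟩`
  (`ObstructionCalculus.evalT_fromCols_eq_zero_of_generic`, density of invertible triples) and every tensor of rank `≤ m`
  in the cubic format `m` is `[A|B|C]` (`exists_eq_sum_triad_of_tensorRank_le`), so `f ∈ RV_m`.
* §2 PADDING IS AN ACTION (`padTensor_eq_actTensor`): `pad_e(t) = (P_e ⊗ P_e ⊗ P_e)·t` for the `0/1` padding matrix, so
  the pull-back `g(t) := f((A⊗B⊗C)·pad(t))` is a double `bind₁` along degree-`1` forms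
  (`ObstructionDescentHullCalculus.actForm`): `deg g ≤ deg f` and `g ∈ RV_m` on the CORNER format `(ℂ^N)^{⊗3}`
  (`bind₁_actForm_mem_RV`, rank is restriction-monotone).
* §3 CONE LEMMA (`homogeneousComponent_mem_RV`): `σ_m` is a cone, so each homogeneous component of `g` is in `RV_m`
  (scaling identity `eval_smul_pt` from the polarisation kernel `Dpoly_diag`, then a one-variable polynomial in the
  scaling parameter with infinitely many roots, `Polynomial.funext`).
* §4 LOW DEGREE ⟹ ZERO (`rv_eq_zero_of_degree_le`): components of degree `m < k ≤ 2m − 3N + 4` vanish by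
  GAP PROPAGATION (`gapPropagation_holds`, item 27779) fed with GAP-ONE EMPTINESS from degree `3N − 2` on
  (`gapOneEquationsVanish_holds`, item 27778); what is left has degree `≤ m` and vanishes by format-degree blindness
  (`ObstructionDescentTorusLaws.eq_zero_of_totalDegree_le`).  Hence `g = 0`, and `g(t) = f((A⊗B⊗C)·pad(t))`.

References: [cite: LandsbergManivel2004, Lemma 3.1 / Prop. 3.3 (prolongation and inheritance)];
[cite: LandsbergGCT2017, §8.3.2 (equations of secant varieties, degree hulls)]; [cite: BurgisserIkenmeyer2011, §3.1 and
Lemma 3.2 (orbit of the unit tensor, density)]; [cite: Blaser2013, Lemma 5.4 (restriction monotonicity)].  The degree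
window `2m − 3N + 4` is this cell's (NODE-g23 §2–§4).

STATUS: this file's `doubleDegreeBlind_holds` is the deciding theorem of route item
`stmt-MatrixMultiplication-27780` (`DoubleDegreeBlind`, aside of `ObstructionDescent`).
-/

namespace Summit.MatrixMultiplication.MatrixMultiplication.Theorems.ObstructionDescentDoubleDegree

open MvPolynomial Finset
open ObstructionDescentPolarForm ObstructionDescentPolarLinear ObstructionDescentGapOne ObstructionDescentGapPropagation
open ObstructionDescentTorusLaws (RV mem_RV eq_zero_of_totalDegree_le)
open ObstructionDescentCountingEquations (totalDegree_bind₁_le_mul)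
open ObstructionDescentHullCalculus (actForm totalDegree_actForm_le aeval_bind₁_actForm bind₁_actForm_mem_RV)
open ObstructionCalculus (Idx Tensor fromCols evalT evalT_fromCols_eq_zero_of_generic actTensor_unitTensor padTensor
  sum_idx3)
open Literature.Computability.AlgebraicComplexity (triad tensorRank actTensor actTensor_apply unitTensor
  exists_eq_sum_triad_of_tensorRank_le tensorRank_smul_le)

variable {N m : ℕ}

/-! ## §1 Orbit ⟹ secant: vanishing on `GL_m³·⟨m⟩` is vanishing on `σ_m ⊂ (ℂ^m)^{⊗3}` -/

/-- ORBIT ⟹ SECANT.  A polynomial vanishing on the orbit `GL_m³·⟨m⟩` vanishes at every tensor of rank `≤ m` of the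
cubic format `m`: invertible triples are Zariski dense in all triples, and a rank-`≤ m` tensor is `[A|B|C]` (columns =
the zero-padded factors of a length-`m` decomposition). [cite: BurgisserIkenmeyer2011, §3.1; Blaser2013, §4] -/
theorem mem_RV_of_orbit (f : MvPolynomial (Idx m) ℂ)
    (hvan : ∀ A B C : Matrix (Fin m) (Fin m) ℂ, A.det ≠ 0 → B.det ≠ 0 → C.det ≠ 0 →
      MvPolynomial.aeval (fun p : Idx m => actTensor A B C (unitTensor ℂ m) p.1 p.2.1 p.2.2) f = 0) :
    f ∈ RV (Fin m) (Fin m) (Fin m) m := by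
  have hall : ∀ A B C : Matrix (Fin m) (Fin m) ℂ, evalT (fromCols A B C) f = 0 := by
    refine evalT_fromCols_eq_zero_of_generic f fun A B C hA hB hC => ?_
    rw [← actTensor_unitTensor]
    exact hvan A B C hA hB hC
  rw [mem_RV]
  intro s hs
  obtain ⟨w, u, v, hdec⟩ := exists_eq_sum_triad_of_tensorRank_le hs
  have hs' : s = fromCols (fun a l => w l a) (fun b l => u l b) (fun c l => v l c) := by
    rw [hdec]
    rfl
  have h := hall (fun a l => w l a) (fun b l => u l b) (fun c l => v l c)
  rw [← hs'] at h
  exact h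

/-! ## §2 Padding is an action by rectangular matrices -/

variable {ι : Type} [Fintype ι]

/-- The `0/1` padding matrix of an index map `e : ι → Fin m`: `P a i = [e i = a]`. [bookkeeping] -/
def padMat (e : ι → Fin m) : Matrix (Fin m) ι ℂ := fun a i => if e i = a then 1 else 0

/-- Zero-padding along `e` is the action of `P_e ⊗ P_e ⊗ P_e`. [bookkeeping; BurgisserIkenmeyer2011 §2] -/
theorem padTensor_eq_actTensor (e : ι → Fin m) (t : ι → ι → ι → ℂ) :
    padTensor e t = actTensor (padMat e) (padMat e) (padMat e) t := by
  funext a b c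
  rw [actTensor_apply]
  simp only [padTensor]
  rw [sum_idx3]
  refine Finset.sum_congr rfl fun i _ => Finset.sum_congr rfl fun j _ => Finset.sum_congr rfl fun k _ => ?_
  simp only [padMat]
  by_cases h₁ : e i = a <;> by_cases h₂ : e j = b <;> by_cases h₃ : e k = c <;> simp [h₁, h₂, h₃]

/-! ## §3 The cone lemma: homogeneous components of equations of `σ_m` are equations of `σ_m` -/

/-- SCALING: a homogeneous polynomial of degree `e` satisfies `f(c·x) = c^e · f(x)` (the one-slot case of the diagonal
identity `Dpoly_diag`). [bookkeeping] -/
theorem eval_smul_pt (f : MvPolynomial (Pt N) ℂ) {e : ℕ} (hf : f.IsHomogeneous e) (x : Pt N → ℂ) (c : ℂ) :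
    eval (fun p => c * x p) f = c ^ e * eval x f := by
  have hfun : (fun p : Pt N => ∑ _k : Fin 1, c * x p) = fun p => c * x p := by
    funext p
    simp
  have h1 : eval (fun _ : Fin 1 => c) (Dpoly f (fun _ : Fin 1 => x)) = eval (fun p => c * x p) f := by
    rw [eval_Dpoly, hfun]
  rw [← h1, Dpoly_diag f hf x]
  simp only [map_mul, map_pow, eval_C, eval_X, Finset.univ_unique, Finset.sum_singleton]
  ring

/-- CONE LEMMA.  `σ_m` is stable under scaling, so if `g` vanishes on `σ_m` then so does every homogeneous component of
`g`: `0 = g(c·u) = Σ_k c^k g_k(u)` for all `c ∈ ℂ`, a one-variable polynomial with infinitely many roots.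
[folklore; LandsbergGCT2017 §8.3.2] -/
theorem homogeneousComponent_mem_RV (g : MvPolynomial (Pt N) ℂ) (hg : g ∈ RV (Fin N) (Fin N) (Fin N) m) (k : ℕ) :
    homogeneousComponent k g ∈ RV (Fin N) (Fin N) (Fin N) m := by
  classical
  rw [mem_RV]
  intro u hu
  -- the values `a i = g_i(u)` and the vanishing of `Σ_i c^i a_i`
  have hvan : ∀ c : ℂ, ∑ i ∈ range (g.totalDegree + 1),
      c ^ i * eval (fun p : Pt N => u p.1 p.2.1 p.2.2) (homogeneousComponent i g) = 0 := by
    intro c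
    have hcu : tensorRank (c • u) ≤ m := (tensorRank_smul_le c u).trans hu
    have h0 := mem_RV.1 hg (c • u) hcu
    rw [aeval_eq_eval_pt] at h0
    have hpt : (fun p : Pt N => (c • u) p.1 p.2.1 p.2.2) = fun p => c * u p.1 p.2.1 p.2.2 := by
      funext p
      simp [Pi.smul_apply]
    rw [hpt] at h0
    have hexp : eval (fun p : Pt N => c * u p.1 p.2.1 p.2.2) g = ∑ i ∈ range (g.totalDegree + 1),
        c ^ i * eval (fun p : Pt N => u p.1 p.2.1 p.2.2) (homogeneousComponent i g) := by
      conv_lhs => rw [← sum_homogeneousComponent g]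
      rw [map_sum]
      exact Finset.sum_congr rfl fun i _ => eval_smul_pt _ (homogeneousComponent_isHomogeneous i g) _ c
    rw [← hexp]
    exact h0
  -- the one-variable polynomial `Σ_i a_i X^i` vanishes identically
  have hP : (∑ i ∈ range (g.totalDegree + 1), Polynomial.C (eval (fun p : Pt N => u p.1 p.2.1 p.2.2)
      (homogeneousComponent i g)) * Polynomial.X ^ i : Polynomial ℂ) = 0 := by
    apply Polynomial.funext
    intro c
    rw [Polynomial.eval_zero, Polynomial.eval_finsetSum]
    simp only [Polynomial.eval_mul, Polynomial.eval_C, Polynomial.eval_pow, Polynomial.eval_X]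
    calc ∑ i ∈ range (g.totalDegree + 1), eval (fun p : Pt N => u p.1 p.2.1 p.2.2) (homogeneousComponent i g) * c ^ i
        = ∑ i ∈ range (g.totalDegree + 1), c ^ i * eval (fun p : Pt N => u p.1 p.2.1 p.2.2)
            (homogeneousComponent i g) := Finset.sum_congr rfl fun i _ => mul_comm _ _
      _ = 0 := hvan c
  have hcoeff := congrArg (fun P : Polynomial ℂ => P.coeff k) hP
  simp only [Polynomial.finsetSum_coeff, Polynomial.coeff_C_mul_X_pow, Polynomial.coeff_zero,
    Finset.sum_ite_eq, Finset.mem_range] at hcoeff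
  rw [aeval_eq_eval_pt]
  by_cases hk : k < g.totalDegree + 1
  · rw [if_pos hk] at hcoeff
    exact hcoeff
  · rw [homogeneousComponent_eq_zero (n := k) (φ := g) (by omega), map_zero]

/-! ## §4 The corner alternative: low-degree equations of `σ_m ⊂ (ℂ^N)^{⊗3}` vanish -/

/-- LOW DEGREE ⟹ ZERO on the corner.  For `2 ≤ N`, an equation of `σ_m((ℂ^N)^{⊗3})` of total degree
`≤ 2m − 3N + 4` is the zero polynomial: its components of degree `> m` vanish by gap propagation from the gap-one
threshold `3N − 2` (items 27779, 27778), the rest by format-degree blindness. [this cell, NODE-g23 §4] -/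
theorem rv_eq_zero_of_degree_le (hN : 2 ≤ N) (g : MvPolynomial (Pt N) ℂ)
    (hg : g ∈ RV (Fin N) (Fin N) (Fin N) m) (hdeg : g.totalDegree + 3 * N ≤ 2 * m + 4) : g = 0 := by
  classical
  -- gap-one emptiness from degree `3N - 2` on, in the shape gap propagation consumes
  have hGap : ∀ d : ℕ, 3 * N - 2 ≤ d → ∀ f : MvPolynomial (Fin N × Fin N × Fin N) ℂ, f.IsHomogeneous d →
      (∀ t : Fin N → Fin N → Fin N → ℂ, tensorRank t < d →
        MvPolynomial.aeval (fun p : Fin N × Fin N × Fin N => t p.1 p.2.1 p.2.2) f = 0) → f = 0 :=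
    fun d hd f hf hv => gapOneEquationsVanish_holds N d hN (by omega) f hf hv
  -- every component of degree `> m` vanishes
  have hhigh : ∀ k, m < k → homogeneousComponent k g = 0 := by
    intro k hk
    by_cases hkD : g.totalDegree < k
    · exact homogeneousComponent_eq_zero (n := k) (φ := g) hkD
    · have hkD' : k ≤ g.totalDegree := not_lt.mp hkD
      exact gapPropagation_holds N (3 * N - 2) hGap m k hk (by omega) _ (homogeneousComponent_isHomogeneous k g)
        fun t ht => mem_RV.1 (homogeneousComponent_mem_RV g hg k) t ht
  -- hence `g` is its part of degree `≤ m`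
  have hsum : g = ∑ i ∈ (range (g.totalDegree + 1)).filter (fun i => i ≤ m), homogeneousComponent i g := by
    conv_lhs => rw [← sum_homogeneousComponent g]
    rw [← Finset.sum_filter_add_sum_filter_not (range (g.totalDegree + 1)) (fun i => i ≤ m)]
    have hz : ∑ i ∈ (range (g.totalDegree + 1)).filter (fun i => ¬ i ≤ m), homogeneousComponent i g = 0 :=
      Finset.sum_eq_zero fun i hi => hhigh i (not_le.mp (Finset.mem_filter.mp hi).2)
    rw [hz, add_zero]
  have hD : g.totalDegree ≤ m := by
    rw [hsum]
    refine (totalDegree_finsetSum _ _).trans (Finset.sup_le fun i hi => ?_)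
    exact (homogeneousComponent_isHomogeneous i g).totalDegree_le.trans (Finset.mem_filter.mp hi).2
  exact eq_zero_of_totalDegree_le hg hD

/-! ## §5 The route item -/

/-- **DOUBLE-DEGREE BLINDNESS** (aside `DoubleDegreeBlind` of route `ObstructionDescent`, item 27780; NODE-g23 §4,
Corollary D).  If `2 ≤ N ≤ m` and `f` of degree `≤ 2m − 3N + 4` vanishes on `GL_m³·⟨m⟩`, then `f` vanishes at
`(A ⊗ B ⊗ C)·pad_m(t)` for every corner tensor `t ∈ (ℂ^N)^{⊗3}` and all `A, B, C ∈ Mat_m(ℂ)`.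
[this cell; cites: LandsbergManivel2004 Prop. 3.3, LandsbergGCT2017 §8.3.2, BurgisserIkenmeyer2011 §3.1, Blaser2013
Lemma 5.4] -/
theorem doubleDegreeBlind_holds :
    Summit.MatrixMultiplication.MatrixMultiplication.Theses.ObstructionDescent.DoubleDegreeBlind := by
  intro N m h hN f hdeg hvan t A B C
  classical
  have hRV : f ∈ RV (Fin m) (Fin m) (Fin m) m := mem_RV_of_orbit f hvan
  -- the pulled-back corner polynomial `g(t) = f((A⊗B⊗C)·(P⊗P⊗P)·t)`
  have hgRV : MvPolynomial.bind₁ (actForm (padMat (Fin.castLE h)) (padMat (Fin.castLE h)) (padMat (Fin.castLE h)))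
      (MvPolynomial.bind₁ (actForm A B C) f) ∈ RV (Fin N) (Fin N) (Fin N) m :=
    bind₁_actForm_mem_RV _ _ _ (bind₁_actForm_mem_RV A B C hRV)
  have hgdeg : (MvPolynomial.bind₁ (actForm (padMat (Fin.castLE h)) (padMat (Fin.castLE h)) (padMat (Fin.castLE h)))
      (MvPolynomial.bind₁ (actForm A B C) f)).totalDegree ≤ f.totalDegree := by
    refine ((totalDegree_bind₁_le_mul _ 1 (totalDegree_actForm_le _ _ _) _).trans_eq (one_mul _)).trans ?_
    exact (totalDegree_bind₁_le_mul _ 1 (totalDegree_actForm_le A B C) f).trans_eq (one_mul _)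
  have hg0 := rv_eq_zero_of_degree_le hN _ hgRV (by omega)
  -- evaluate at `t`
  have hev : MvPolynomial.aeval (fun p : Pt N => t p.1 p.2.1 p.2.2)
      (MvPolynomial.bind₁ (actForm (padMat (Fin.castLE h)) (padMat (Fin.castLE h)) (padMat (Fin.castLE h)))
        (MvPolynomial.bind₁ (actForm A B C) f)) =
      MvPolynomial.aeval (fun q : Idx m => actTensor A B C (padTensor (Fin.castLE h) t) q.1 q.2.1 q.2.2) f := by
    rw [aeval_bind₁_actForm, aeval_bind₁_actForm, ← padTensor_eq_actTensor]
  have hfin : MvPolynomial.aeval (fun q : Idx m => actTensor A B C (padTensor (Fin.castLE h) t) q.1 q.2.1 q.2.2) f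
      = 0 := by
    rw [← hev, hg0, map_zero]
  exact hfin

end Summit.MatrixMultiplication.MatrixMultiplication.Theorems.ObstructionDescentDoubleDegree
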